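import Mathlib

/-!
# The logarithm of a two-summand local border product via Newton's identities
# (helper for `ChowBorderDepth3.LocalFanInTwo`)

Support file for item `stmt-ValiantsHypothesis-5938` (`LocalFanInTwo`) of route
`ValiantsHypothesis/ChowBorderDepth3`.  Let `u, u' : Fin D → R[x]` be linear forms all divisible
by a scalar `t` (in the item, `t = ε` and `R = ℂ[ε]`), and suppose the two "local products" agree
to order `t^γ`:  `Π_j (1 + u_j) − Π_j (1 + u'_j) = t^γ · U'`.  Then the power sums satisfy

  `Σ_j u_j^n − Σ_j u'_j^n = t^γ · ( (−1)^{n+1} n · U'_n + t · W )`     (`n ≥ 1`),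

where `U'_n` is the degree-`n` homogeneous component of `U'` (`psum_sub_psum_eq`).  Informally:
taking logarithms, `log Π(1+u_j) = Σ_k (−1)^{k+1} p_k(u)/k`, and the difference of two such
logarithms is, to leading order in `t`, the difference of the products.  The proof is the
formal version via Newton's identities (`MvPolynomial.psum_eq_mul_esymm_sub_sum`):
`p_k = (−1)^{k+1} k e_k − Σ_{0<i<k} (−1)^i e_i p_{k−i}`, where `e_k(u) − e_k(u')` is the
degree-`k` component of `t^γ U'` and every `e_i, p_j` (`i, j ≥ 1`) is divisible by `t`.

References: I. G. Macdonald, *Symmetric functions and Hall polynomials*, 2nd ed., OUP 1995,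
§I.2 (Newton's identities); the use here (two local summands linearise to a border Waring
decomposition) is the route's own remark (thesis of `ChowBorderDepth3`, crux analysis (i)).
-/

noncomputable section

-- `Summit.ValiantsHypothesis.ValiantsHypothesis.…` is the tree's mandated single-conjunct layout
-- (Sub = Summit), so the duplicated namespace component is intended.
set_option linter.dupNamespace false

namespace Summit.ValiantsHypothesis.ValiantsHypothesis.Theorems.ChowBorderDepth3LocalFanInTwo

open MvPolynomial

variable {σ R : Type*} [CommRing R] {D : ℕ}

/-- `e_k(u) = Σ_{|A| = k} Π_{j ∈ A} u_j` (evaluation of `MvPolynomial.esymm`). [folklore] -/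
theorem aeval_esymm_eq (u : Fin D → MvPolynomial σ R) (k : ℕ) :
    aeval u (esymm (Fin D) R k) = ∑ A ∈ Finset.powersetCard k Finset.univ, ∏ j ∈ A, u j := by
  simp only [esymm, map_sum, map_prod, aeval_X]

/-- `p_k(u) = Σ_j u_j^k` (evaluation of `MvPolynomial.psum`). [folklore] -/
theorem aeval_psum_eq (u : Fin D → MvPolynomial σ R) (k : ℕ) :
    aeval u (psum (Fin D) R k) = ∑ j, u j ^ k := by
  simp only [psum, map_sum, map_pow, aeval_X]

/-- Newton's identity evaluated at `u`:
`p_k(u) = (−1)^{k+1} k e_k(u) − Σ_{0<i<k} (−1)^i e_i(u) p_{k−i}(u)`. [folklore] -/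
theorem aeval_psum_newton (u : Fin D → MvPolynomial σ R) (k : ℕ) (hk : 0 < k) :
    aeval u (psum (Fin D) R k) =
      (-1 : MvPolynomial σ R) ^ (k + 1) * (k : MvPolynomial σ R) * aeval u (esymm (Fin D) R k) -
      ∑ a ∈ (Finset.HasAntidiagonal.antidiagonal k).filter (fun a => a.1 ∈ Set.Ioo 0 k),
        (-1) ^ a.1 * aeval u (esymm (Fin D) R a.1) * aeval u (psum (Fin D) R a.2) := by
  rw [MvPolynomial.psum_eq_mul_esymm_sub_sum (Fin D) R k hk]
  simp only [map_sub, map_mul, map_pow, map_neg, map_one, map_natCast, map_sum]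

/-- If `t ∣ u_j` for all `j` then `t ∣ e_k(u)` for `k ≥ 1`. [folklore] -/
theorem C_dvd_aeval_esymm (t : R) (u : Fin D → MvPolynomial σ R) (hut : ∀ j, C t ∣ u j) {k : ℕ}
    (hk : 0 < k) : C t ∣ aeval u (esymm (Fin D) R k) := by
  rw [aeval_esymm_eq]
  refine Finset.dvd_sum fun A hA => ?_
  obtain ⟨j, hj⟩ : A.Nonempty := by
    rw [← Finset.card_pos, (Finset.mem_powersetCard.1 hA).2]; exact hk
  exact (hut j).trans (Finset.dvd_prod_of_mem _ hj)

/-- If `t ∣ u_j` for all `j` then `t ∣ p_k(u)` for `k ≥ 1`. [folklore] -/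
theorem C_dvd_aeval_psum (t : R) (u : Fin D → MvPolynomial σ R) (hut : ∀ j, C t ∣ u j) {k : ℕ}
    (hk : 0 < k) : C t ∣ aeval u (psum (Fin D) R k) := by
  rw [aeval_psum_eq]
  exact Finset.dvd_sum fun j _ => (hut j).trans (dvd_pow_self (u j) hk.ne')

/-- For linear forms `u_j`, the degree-`k` component of `Π_j (1 + u_j)` is `e_k(u)`. [folklore] -/
theorem homogeneousComponent_prod_one_add (u : Fin D → MvPolynomial σ R)
    (hu1 : ∀ j, (u j).IsHomogeneous 1) (k : ℕ) :
    homogeneousComponent k (∏ j, (1 + u j)) = aeval u (esymm (Fin D) R k) := by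
  classical
  rw [Finset.prod_one_add, aeval_esymm_eq, map_sum, Finset.powersetCard_eq_filter,
    Finset.sum_filter]
  refine Finset.sum_congr rfl fun A _ => ?_
  have hhom : (∏ j ∈ A, u j).IsHomogeneous A.card := by
    have := IsHomogeneous.prod A (fun j => u j) (fun _ => 1) (fun j _ => hu1 j)
    rwa [Finset.sum_const, smul_eq_mul, mul_one] at this
  rw [homogeneousComponent_of_mem hhom]
  by_cases h : k = A.card
  · rw [if_pos h, if_pos h.symm]
  · rw [if_neg h, if_neg (Ne.symm h)]

/-- **Power sums of two `t`-close local products are `t^γ`-close**: if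
`e_k(u) − e_k(u') ≡ 0 (mod t^γ)` for all `k`, then `p_k(u) − p_k(u') ≡ 0 (mod t^γ)` for all `k`
(Newton's identities, induction on `k`). [folklore] -/
theorem C_pow_dvd_psum_sub (t : R) (γ : ℕ) (u u' : Fin D → MvPolynomial σ R)
    (hE : ∀ k, C (t ^ γ) ∣ aeval u (esymm (Fin D) R k) - aeval u' (esymm (Fin D) R k)) :
    ∀ k, C (t ^ γ) ∣ aeval u (psum (Fin D) R k) - aeval u' (psum (Fin D) R k) := by
  intro k
  induction k using Nat.strong_induction_on with
  | _ k ih =>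
    rcases Nat.eq_zero_or_pos k with rfl | hk
    · rw [aeval_psum_eq, aeval_psum_eq]
      simp
    rw [aeval_psum_newton u k hk, aeval_psum_newton u' k hk, sub_sub_sub_comm, ← mul_sub,
      ← Finset.sum_sub_distrib]
    refine dvd_sub (Dvd.dvd.mul_left (hE k) _) (Finset.dvd_sum fun a ha => ?_)
    have ha' := Finset.mem_filter.1 ha
    have h1 := Finset.HasAntidiagonal.mem_antidiagonal.1 ha'.1
    have h2 := (Set.mem_Ioo.1 ha'.2)
    have hlt : a.2 < k := by omega
    have key : (-1 : MvPolynomial σ R) ^ a.1 * aeval u (esymm (Fin D) R a.1) *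
        aeval u (psum (Fin D) R a.2) -
        (-1) ^ a.1 * aeval u' (esymm (Fin D) R a.1) * aeval u' (psum (Fin D) R a.2) =
        (-1) ^ a.1 * ((aeval u (esymm (Fin D) R a.1) - aeval u' (esymm (Fin D) R a.1)) *
          aeval u (psum (Fin D) R a.2) + aeval u' (esymm (Fin D) R a.1) *
          (aeval u (psum (Fin D) R a.2) - aeval u' (psum (Fin D) R a.2))) := by ring
    rw [key]
    exact Dvd.dvd.mul_left (dvd_add (Dvd.dvd.mul_right (hE a.1) _)
      (Dvd.dvd.mul_left (ih a.2 hlt) _)) _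

/-- **The leading term**: under the same hypotheses and `t ∣ u_j, u'_j`,
`p_n(u) − p_n(u') ≡ (−1)^{n+1} n (e_n(u) − e_n(u')) (mod t^{γ+1})` for `n ≥ 1`. [folklore] -/
theorem C_pow_succ_dvd_psum_sub (t : R) (γ : ℕ) (u u' : Fin D → MvPolynomial σ R)
    (hut : ∀ j, C t ∣ u j) (hut' : ∀ j, C t ∣ u' j)
    (hE : ∀ k, C (t ^ γ) ∣ aeval u (esymm (Fin D) R k) - aeval u' (esymm (Fin D) R k))
    {n : ℕ} (hn : 0 < n) :
    C (t ^ (γ + 1)) ∣ (aeval u (psum (Fin D) R n) - aeval u' (psum (Fin D) R n)) -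
      (-1 : MvPolynomial σ R) ^ (n + 1) * (n : MvPolynomial σ R) *
        (aeval u (esymm (Fin D) R n) - aeval u' (esymm (Fin D) R n)) := by
  have hP := C_pow_dvd_psum_sub t γ u u' hE
  rw [aeval_psum_newton u n hn, aeval_psum_newton u' n hn, sub_sub_sub_comm, ← mul_sub,
    ← Finset.sum_sub_distrib, sub_sub_cancel_left, dvd_neg]
  refine Finset.dvd_sum fun a ha => ?_
  have ha' := Finset.mem_filter.1 ha
  have h1 := Finset.HasAntidiagonal.mem_antidiagonal.1 ha'.1
  have h2 := (Set.mem_Ioo.1 ha'.2)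
  have hpos : 0 < a.2 := by omega
  have key : (-1 : MvPolynomial σ R) ^ a.1 * aeval u (esymm (Fin D) R a.1) *
      aeval u (psum (Fin D) R a.2) -
      (-1) ^ a.1 * aeval u' (esymm (Fin D) R a.1) * aeval u' (psum (Fin D) R a.2) =
      (-1) ^ a.1 * ((aeval u (esymm (Fin D) R a.1) - aeval u' (esymm (Fin D) R a.1)) *
        aeval u (psum (Fin D) R a.2) + aeval u' (esymm (Fin D) R a.1) *
        (aeval u (psum (Fin D) R a.2) - aeval u' (psum (Fin D) R a.2))) := by ring
  rw [key, show C (t ^ (γ + 1)) = C (t ^ γ) * C t by rw [pow_succ, map_mul]]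
  refine Dvd.dvd.mul_left (dvd_add (mul_dvd_mul (hE a.1) (C_dvd_aeval_psum t u hut hpos)) ?_) _
  rw [mul_comm (C (t ^ γ))]
  exact mul_dvd_mul (C_dvd_aeval_esymm t u' hut' h2.1) (hP a.2)

/-- **Logarithm of a two-summand local border product.**  Let `u, u' : Fin D → R[x]` be linear
forms divisible by `t`, with `Π_j (1 + u_j) − Π_j (1 + u'_j) = t^γ · U'`.  Then for `n ≥ 1`

  `Σ_j u_j^n − Σ_j u'_j^n = t^γ · ((−1)^{n+1} n · U'_n + t · W)`

for some `W`, where `U'_n = homogeneousComponent n U'`: the power sums of the two factor lists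
differ, to leading order in `t`, by `(−1)^{n+1} n` times the degree-`n` part of the difference
of the products (the formal content of "taking logarithms", via Newton's identities).
[folklore] -/
theorem psum_sub_psum_eq (t : R) (γ : ℕ) (u u' : Fin D → MvPolynomial σ R)
    (hu1 : ∀ j, (u j).IsHomogeneous 1) (hu1' : ∀ j, (u' j).IsHomogeneous 1)
    (hut : ∀ j, C t ∣ u j) (hut' : ∀ j, C t ∣ u' j) (U' : MvPolynomial σ R)
    (hU : ∏ j, (1 + u j) - ∏ j, (1 + u' j) = C (t ^ γ) * U') {n : ℕ} (hn : 0 < n) :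
    ∃ W : MvPolynomial σ R, ∑ j, u j ^ n - ∑ j, u' j ^ n =
      C (t ^ γ) * ((-1 : MvPolynomial σ R) ^ (n + 1) * (n : MvPolynomial σ R) *
        homogeneousComponent n U' + C t * W) := by
  have hE : ∀ k, aeval u (esymm (Fin D) R k) - aeval u' (esymm (Fin D) R k) =
      C (t ^ γ) * homogeneousComponent k U' := by
    intro k
    rw [← homogeneousComponent_prod_one_add u hu1, ← homogeneousComponent_prod_one_add u' hu1',
      ← map_sub, hU, homogeneousComponent_C_mul]
  obtain ⟨W₀, hW₀⟩ := C_pow_succ_dvd_psum_sub t γ u u' hut hut'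
    (fun k => ⟨_, hE k⟩) hn
  refine ⟨W₀, ?_⟩
  rw [← aeval_psum_eq u, ← aeval_psum_eq u', eq_add_of_sub_eq' hW₀, hE n,
    show C (t ^ (γ + 1)) = C (t ^ γ) * C t by rw [pow_succ, map_mul]]
  ring

end Summit.ValiantsHypothesis.ValiantsHypothesis.Theorems.ChowBorderDepth3LocalFanInTwo

end
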